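import Literature.Topology.FourManifolds.SliceRibbon
import Literature.Topology.FourManifolds.HomotopyBallSliceProofs
import Literature.Topology.FourManifolds.DiffeotopyProofs
import Literature.Topology.FourManifolds.RadialExtension
import HarnessLib

/-!
# Smooth sliceness is an isotopy invariant: discharge of `Knot.IsSmoothlySlice.of_isIsotopic`

Sibling proof file of `Literature/Topology/FourManifolds/SliceRibbon.lean`, which vendors the
named fact

* `Literature.Topology.FourManifolds.Knot.IsSmoothlySlice.of_isIsotopic :
    ∀ {K K' : Knot}, K.IsIsotopic K' → K.IsSmoothlySlice → K'.IsSmoothlySlice`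

("smooth sliceness is an invariant of the knot type: an ambient isotopy of `𝕊 3` extends
radially (damped near the origin) to a diffeomorphism of `B⁴` carrying slice discs to slice
discs"; Livingston, *A survey of classical knot concordance* (2005), §2.1, where knots and slice
knots are *defined* as diffeomorphism classes of pairs `(S³, K)`, resp. by `∂(B⁴, D²) = K`, so
that sliceness is a property of the knot type by definition; in the tree's parametrised setting
this is the present theorem). It is proved here, sorry-free:
`Literature.Topology.FourManifolds.Knot.IsSmoothlySlice.of_isIsotopic_holds`.

## The proof

Let `F` be an ambient isotopy of `𝕊 3` with `F 1 ∘ K = K'` and `f : ℝ² → ℝ⁴` a slice disc for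
`K` (`Knot.IsSliceDisc`). By the tree's `AmbientIsotopy.exists_diffeotopy_toFun_eq_invFun_eq`
(`DiffeotopyProofs.lean`; Hirsch (1976), Ch. 8 §1: the track of a diffeotopy is a
diffeomorphism) `F` is the stage family of a diffeotopy `D` of `𝕊 3`, and the tree's **radial
extension** `Φ = radialExtensionFun D.toFun : ℝ⁴ → ℝ⁴`, `x ↦ ‖x‖ · D_{radialStep ‖x‖}(x/‖x‖)`
(`RadialExtension.lean`; Cerf (1968), Ch. I §1, proof of Lemme 2) is `C^∞`, norm-preserving,
restricts to `D 1 = F 1` on the unit sphere and has the `C^∞` left inverse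
`radialExtensionFun D.invFun`; hence `dΦ` is everywhere injective (chain rule,
`injective_fderiv_of_leftInverse`) and `Φ ∘ f` satisfies every clause of `Knot.IsSliceDisc K'`
except possibly neatness, i.e. it is a *proper* slice disc for `K'` (`Knot.IsProperDisc`,
`HomotopyBallSliceProofs.lean`); the tree's neatening theorem
`Knot.isSmoothlySlice_of_isProperDisc_holds` (ibid.) finishes the proof.

## References

* C. Livingston, *A survey of classical knot concordance*, in: Handbook of Knot Theory (2005),
  §2.1 (held: arXiv math/0307077, p. 3). [Livingston2005]
* M. W. Hirsch, *Differential Topology*, GTM 33 (1976), Ch. 8 §1, p. 178–180 (ambient isotopy,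
  diffeotopy, isotopy extension). [HirschDT1976]
* J. Cerf, *Sur les difféomorphismes de la sphère de dimension trois (Γ₄ = 0)*, LNM 53 (1968),
  Ch. I §1, Lemme 2 (radial extension). [CerfDiffeoSphere1968]
* R. H. Fox, *A quick trip through knot theory* (1962), §7 (slice knots). [Fox1962]

## Design notes

* No statement of another file is modified; no new named fact; no `sorry`; the radial extension
  and the diffeotopy of an ambient isotopy are reused from the tree (`RadialExtension.lean`,
  `DiffeotopyProofs.lean`), only the transport of slice discs is new (revision of p26159 per
  review: no second copy of the radial-extension API).
* `𝔼 n`, `𝕊 n` are local notation exactly as in `SliceRibbon.lean`.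
-/

open scoped Manifold ContDiff Topology
open Function Set Metric

noncomputable section

namespace Literature.Topology.FourManifolds

/-- Local notation: `𝔼 n` is the model Euclidean space `EuclideanSpace ℝ (Fin n)`. -/
local notation "𝔼 " n:arg => EuclideanSpace ℝ (Fin n)

/-- Local notation: `𝕊 n` is the unit sphere in `EuclideanSpace ℝ (Fin (n + 1))`. -/
local notation "𝕊 " n:arg => (Metric.sphere (0 : EuclideanSpace ℝ (Fin (n + 1))) 1)

/-- **A differentiable map with a differentiable left inverse is an immersion**: if `Ψ ∘ Φ = id`
with `Φ`, `Ψ` differentiable, then `dΦ` is injective at every point (chain rule: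
`dΨ ∘ dΦ = id`). [folklore] -/
theorem injective_fderiv_of_leftInverse {E : Type*} [NormedAddCommGroup E] [NormedSpace ℝ E]
    {Φ Ψ : E → E} (hΦ : Differentiable ℝ Φ) (hΨ : Differentiable ℝ Ψ) (h : LeftInverse Ψ Φ)
    (y : E) : Injective (fderiv ℝ Φ y) := by
  have hcomp : HasFDerivAt (Ψ ∘ Φ) ((fderiv ℝ Ψ (Φ y)).comp (fderiv ℝ Φ y)) y :=
    (hΨ (Φ y)).hasFDerivAt.comp y (hΦ y).hasFDerivAt
  have hid : Ψ ∘ Φ = id := funext h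
  rw [hid] at hcomp
  have heq : (fderiv ℝ Ψ (Φ y)).comp (fderiv ℝ Φ y) = ContinuousLinearMap.id ℝ E :=
    hcomp.unique (hasFDerivAt_id y)
  intro v w hvw
  have := congrArg (fderiv ℝ Ψ (Φ y)) hvw
  rw [← ContinuousLinearMap.comp_apply, ← ContinuousLinearMap.comp_apply, heq] at this
  simpa using this

namespace Knot

/-- **Transport of a slice disc along a diffeotopy of `𝕊 3`.** If `D 1 ∘ K = K'` for a
diffeotopy `D` of `𝕊 3` and `f` is a slice disc for `K`, then `Φ ∘ f`, with
`Φ = radialExtensionFun D.toFun` the radial extension of `D` to `ℝ⁴` (`RadialExtension.lean`),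
is a proper slice disc for `K'`: `Φ` is `C^∞` (`contDiff_radialExtensionFun`), injective with
the `C^∞` left inverse `radialExtensionFun D.invFun` (hence an immersion), norm-preserving, and
equal to `D 1` on the unit sphere. Livingston (2005), §2.1 (sliceness is a property of the knot
type). [cite: Livingston2005, §2.1] -/
theorem IsSliceDisc.isProperDisc_radialExtensionFun_comp {K K' : Knot}
    (D : Diffeotopy (𝓡 3) (𝕊 3)) (hD : D.toFun 1 ∘ ⇑K = ⇑K') {f : 𝔼 2 → 𝔼 4}
    (hf : K.IsSliceDisc f) : K'.IsProperDisc (radialExtensionFun D.toFun ∘ f) := by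
  obtain ⟨hf1, hf2, hf3, hf4, -, hf6⟩ := hf
  have hn : (∞ : ℕ∞ω) ≠ 0 := by simp
  have hΦ : ContDiff ℝ ∞ (radialExtensionFun (n := 3) D.toFun) :=
    contDiff_radialExtensionFun D.contMDiff_uncurry_toFun D.toFun_zero
  have hΨ : ContDiff ℝ ∞ (radialExtensionFun (n := 3) D.invFun) :=
    contDiff_radialExtensionFun D.contMDiff_uncurry_invFun D.invFun_zero
  have hleft : LeftInverse (radialExtensionFun (n := 3) D.invFun) (radialExtensionFun D.toFun) :=
    radialExtensionFun_radialExtensionFun D.invFun_toFun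
  refine ⟨hΦ.comp hf1, hleft.injective.comp_injOn hf2, fun x hx ↦ ?_, fun x hx ↦ ?_, fun x ↦ ?_⟩
  · rw [fderiv_comp x (hΦ.differentiable hn _) (hf1.differentiable hn x)]
    exact (injective_fderiv_of_leftInverse (hΦ.differentiable hn) (hΨ.differentiable hn) hleft
      (f x)).comp (hf3 x hx)
  · rw [Function.comp_apply, norm_radialExtensionFun]
    exact hf4 x hx
  · rw [Function.comp_apply, hf6 x, radialExtensionFun_coe_sphere, ← hD, Function.comp_apply]

/-- **Smooth sliceness is an isotopy invariant** (theorem form): an ambient isotopy of `𝕊 3`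
is the stage family of a diffeotopy (`AmbientIsotopy.exists_diffeotopy_toFun_eq_invFun_eq`,
Hirsch (1976), Ch. 8 §1), whose radial extension transports slice discs to proper slice discs
(`IsSliceDisc.isProperDisc_radialExtensionFun_comp`), and proper slice discs can be neatened
(`isSmoothlySlice_of_isProperDisc_holds`). Livingston (2005), §2.1. [cite: Livingston2005, §2.1] -/
theorem IsSmoothlySlice.of_isIsotopic' {K K' : Knot} (h : K.IsIsotopic K')
    (hs : K.IsSmoothlySlice) : K'.IsSmoothlySlice := by
  obtain ⟨F, hF⟩ := h
  obtain ⟨D, hD, -⟩ := F.exists_diffeotopy_toFun_eq_invFun_eq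
  obtain ⟨f, hf⟩ := hs
  have hD1 : D.toFun 1 ∘ ⇑K = ⇑K' := by rw [hD]; exact hF
  exact isSmoothlySlice_of_isProperDisc_holds K' _ (hf.isProperDisc_radialExtensionFun_comp D hD1)

/-- **Discharge** of the named fact `Knot.IsSmoothlySlice.of_isIsotopic` (`SliceRibbon.lean`):
smooth sliceness is an invariant of the knot type. Livingston (2005), §2.1; Hirsch (1976),
Ch. 8 §1. [cite: Livingston2005, §2.1] -/
theorem IsSmoothlySlice.of_isIsotopic_holds : IsSmoothlySlice.of_isIsotopic :=
  fun h hs ↦ hs.of_isIsotopic' h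

/-- Smooth sliceness is invariant under isotopy, as an `iff` (the two directions of an isotopy
are taken as hypotheses; symmetry of isotopy is `SphereEmbedding.IsIsotopic.symm_holds` of
`KnotsIsotopyProofs.lean`, not imported here). [folklore] -/
theorem isSmoothlySlice_congr {K K' : Knot} (h : K.IsIsotopic K') (h' : K'.IsIsotopic K) :
    K.IsSmoothlySlice ↔ K'.IsSmoothlySlice :=
  ⟨fun hs ↦ hs.of_isIsotopic' h, fun hs ↦ hs.of_isIsotopic' h'⟩

end Knot

end Literature.Topology.FourManifolds
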